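import Mathlib
import Literature.Computability.AlgebraicComplexity.HessianAtOrigin
import Summits.ValiantsHypothesis.ValiantsHypothesis.Theorems.RefutationDegreeMrCalibrationMinors

/-!
# The translation as a linear substitution on coefficient space (crux `BeyondHessianNs`)

Helper file for crux item stmt-ValiantsHypothesis-5641 (`RefutationDegree.BeyondHessianNs`),
stub `stub_translFunctional` (plumbing step W4) of the line `Sketch`.

For a point `y : σ → ℂ` (`σ = Fin n × Fin n`) and a degree bound `d`, the translation
`g ↦ g(X + y)` (`Literature.Computability.AlgebraicComplexity.transl`) acts on polynomials `g` of
total degree `≤ d` as a LINEAR SUBSTITUTION on coefficient space with complex coefficients,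
functorially in the commutative ring `K` receiving `ℂ` via a ring map `φ`: every coefficient
`coeff ν (g(X + φ ∘ y))` is `T ν (g)` ("`T ν (g)`" meaning `eval₂ φ (fun μ => coeff μ g) (T ν)`)
for ONE polynomial `T ν` of total degree `≤ 1` in the coefficient variables `X_μ` (`μ : σ →₀ ℕ`):

`T ν = Σ_{μ ∈ S_d} coeff_ν ((X + y)^μ) · X_μ`, where `S_d = ⋃_{k ≤ d} univ.finsuppAntidiag k` is the
finite set of exponents of degree `≤ d` (the same set as in W1,
`RefutationDegreeBeyondHessianNsStubDerivFunctional.lean`).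

Proof of the identity: `g = Σ_{μ ∈ S_d} g_μ x^μ` (`MvPolynomial.as_sum` and `supp g ⊆ S_d` by
`MvPolynomial.le_totalDegree`), `transl` is a ring map fixing constants, and the naturality
`(X + φ ∘ y)^μ = map φ ((X + y)^μ)` (`RefutationDegreeMrCalibration.map_transl`), whence
`coeff_ν ((g_μ x^μ)(X + φ ∘ y)) = φ (coeff_ν ((X + y)^μ)) · g_μ`.
-/

noncomputable section

-- single-conjunct layout: Sub = Summit, duplicated namespace component intended
set_option linter.dupNamespace false

namespace Summit.ValiantsHypothesis.ValiantsHypothesis.Theorems.RefutationDegreeBeyondHessianNs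

open MvPolynomial Literature.Computability.AlgebraicComplexity

section General

variable {σ : Type*} {K : Type*} [CommRing K]

/-- Functoriality of the coefficients of the translate of a term in the coefficient ring:
`coeff_ν ((c · x^μ)(X + φ ∘ y)) = φ (coeff_ν ((X + y)^μ)) · c`. [folklore] -/
theorem coeff_transl_monomial_eq (φ : ℂ →+* K) (y : σ → ℂ) (μ ν : σ →₀ ℕ) (c : K) :
    coeff ν (transl (fun s => φ (y s)) (monomial μ c)) =
      φ (coeff ν (transl y (monomial μ (1 : ℂ)))) * c := by
  have h1 : monomial μ c = C c * monomial μ 1 := by rw [C_mul_monomial, mul_one]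
  rw [h1, map_mul, transl_C, coeff_C_mul, mul_comm, ← coeff_map,
    RefutationDegreeMrCalibration.map_transl, map_monomial, φ.map_one]
  rfl

/-- A polynomial of total degree `≤ d` is the sum of its terms over the finite set
`⋃_{k < d + 1} univ.finsuppAntidiag k` of exponents of degree `≤ d`
(cf. `MvPolynomial.as_sum`). [folklore] -/
theorem sum_biUnion_finsuppAntidiag_monomial_coeff [Fintype σ] [DecidableEq σ] {d : ℕ}
    {g : MvPolynomial σ K} (hg : g.totalDegree ≤ d) :
    ∑ μ ∈ (Finset.range (d + 1)).biUnion (fun k => (Finset.univ : Finset σ).finsuppAntidiag k),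
      monomial μ (coeff μ g) = g := by
  have hS : g.support ⊆
      (Finset.range (d + 1)).biUnion (fun k => (Finset.univ : Finset σ).finsuppAntidiag k) :=
    fun μ hμ => Finset.mem_biUnion.mpr ⟨_, Finset.mem_range.mpr
      (Nat.lt_succ_of_le ((le_totalDegree hμ).trans hg)),
        Finset.mem_finsuppAntidiag'.mpr ⟨rfl, Finset.subset_univ _⟩⟩
  conv_rhs => rw [g.as_sum]
  exact (Finset.sum_subset hS fun μ _ hμ => by rw [notMem_support_iff.mp hμ, monomial_zero]).symm

end General

/-- **W4 — the translation functional**: on polynomials of degree `≤ d`, each coefficient of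
`g(X + y)` is a linear form in the coefficients of `g` with complex coefficients, functorial in
the coefficient ring: `T ν = Σ_{|μ| ≤ d} coeff_ν ((X + y)^μ) · X_μ` (stub `stub_translFunctional`
of the line `Sketch`). [folklore] -/
theorem stub_translFunctional : ∀ (n d : ℕ) (y : Fin n × Fin n → ℂ),
    ∃ T : (Fin n × Fin n →₀ ℕ) → MvPolynomial (Fin n × Fin n →₀ ℕ) ℂ, (∀ ν, (T ν).totalDegree ≤ 1) ∧
      ∀ (K : Type) [CommRing K] (φ : ℂ →+* K) (g : MvPolynomial (Fin n × Fin n) K),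
        g.totalDegree ≤ d → ∀ ν,
          MvPolynomial.eval₂ φ (fun μ => MvPolynomial.coeff μ g) (T ν) =
            MvPolynomial.coeff ν
              (Literature.Computability.AlgebraicComplexity.transl (fun s => φ (y s)) g) := by
  intro n d y
  refine ⟨fun ν => ∑ μ ∈ (Finset.range (d + 1)).biUnion
      (fun k => (Finset.univ : Finset (Fin n × Fin n)).finsuppAntidiag k),
      C (coeff ν (transl y (monomial μ (1 : ℂ)))) * X μ, ?_, ?_⟩
  · intro ν
    refine totalDegree_finsetSum_le fun μ _ => (totalDegree_mul _ _).trans ?_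
    rw [totalDegree_C, totalDegree_X, zero_add]
  · intro K _ φ g hg ν
    rw [eval₂_sum]
    simp only [eval₂_mul, eval₂_C, eval₂_X]
    conv_rhs => rw [← sum_biUnion_finsuppAntidiag_monomial_coeff hg, map_sum, coeff_sum]
    exact Finset.sum_congr rfl fun μ _ => (coeff_transl_monomial_eq φ y μ ν _).symm

end Summit.ValiantsHypothesis.ValiantsHypothesis.Theorems.RefutationDegreeBeyondHessianNs
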